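import Literature.NumberTheory.Transcendental.DiazThm2FromCh8
import Literature.NumberTheory.Transcendental.DiazMainProofs
import Literature.NumberTheory.Transcendental.ExpSmallTrdegProofsI
import HarnessLib

/-!
# Laurent's transcription of Diaz's theorem, assertion i) (`Diaz1989_main_i`), from Philippon's criterion and the zero lemma

Topic `Literature/NumberTheory/Transcendental`. Third proofs sibling of `DiazMain.lean` for the
named fact `Literature.NumberTheory.Transcendental.Diaz1989_main_i` — M. Laurent, *Sur quelques
résultats récents de transcendance*, Journées Arithmétiques de Luminy 1989, Astérisque 198–200
(1991), §3.1, Théorème 3 i), p. 213 ("extrait de [9]" = G. Diaz, J. Number Theory 31 (1989),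
Théorème 2): for `ℚ`-linearly independent `x₁,…,x_m`, `y₁,…,y_n ∈ ℂ` with
`log|∑ λᵢxᵢ| ≫ -max|λᵢ|` and `log|∑ μⱼyⱼ| ≫ -(max|μⱼ|)^{η₁}`, `η₁ = mn/(2m+n)`, and
`m ≥ 2, n ≥ 3` or `m ≥ 3, n ≥ 2`, one has `trdeg_ℚ ℚ(e^{xᵢyⱼ}) ≥ [mn/(m+n)]`. (The first sibling
`DiazMainProofs.lean` settles the range `[mn/(m+n)] ≤ 1` by the six exponentials theorem and
reduces the fact to its large range `2(m+n) ≤ mn`, `Diaz1989_main_i_of_largeRange`; this file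
carries the heavy imports of Diaz's construction.) Everything here is PROVED; no definition, no
named fact is introduced. Main results:

* `Diaz1989_main_i_of_criterion :
    Philippon1986_mainCriterion → Diaz1989_zeroLemma → Diaz1989_main_i`;
* `Diaz1989_main_i_of_philippon :
    Philippon1986_mainCriterion → Philippon1986_GaGm_P1n → Diaz1989_main_i`
  (the zero lemma being proved from Philippon's zero estimate on `𝔾ₐ × 𝔾ₘⁿ`,
  `Diaz1989_zeroLemma_of_P1n`, `DiazZeroLemmaProofs.lean`);
* `Diaz1989_main_i_of_ch8 : NesterenkoPhilippon2001_ch8_cor_1_1 → Diaz1989_zeroLemma →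
    Diaz1989_main_i` and `Diaz1989_main_i_of_ch8_P1n` — the LNM 1752 Ch. 8 Cor. 1.1 route of
  `DiazThm2FromCh8.lean` (through its exponent-free core `le_trdeg_of_eventually_goodX_ch8'`).

So the trust base of `Diaz1989_main_i` is now that of the tree's reduction of Diaz's own
Théorème 2 (`Diaz1989_thm2_of_criterion`, `DiazThm2Proofs.lean`): {Philippon 1986 Thm 2.11 or
LNM 1752 Ch. 8 Cor. 1.1, Philippon's zero estimate on `𝔾ₐ × 𝔾ₘⁿ`}; a discharge of a criterion and
of the zero estimate discharges `Diaz1989_main_i` by a one-liner, e.g.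
`Diaz1989_main_i_of_philippon Philippon1986_mainCriterion_holds Philippon1986_GaGm_P1n_holds`.

What holds UNCONDITIONALLY (last section): the assertion for `mn < 3(m+n)`, i.e. whenever
`[mn/(m+n)] ≤ 2` (`Diaz1989_main_i_midRange`: the six exponentials theorem for `[mn/(m+n)] ≤ 1`,
and LNM 1752 Ch. 13 Thm 3.1 (i), now proved in the tree — `Laurent2001_thm_3_1_i_holds`,
`ExpSmallTrdegProofsI.lean` — for `[mn/(m+n)] = 2`; no measure of linear independence is used,
as announced in Laurent's Remarque 3, p. 214), so that the tools are only needed in the range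
`3(m+n) ≤ mn` (`Diaz1989_main_i_of_range_three_le`, `Diaz1989_main_i_iff_range_three_le`).

## Why this is not a corollary of the vendored `Diaz1989_thm2`, and what is proved instead

Laurent's hypotheses are *weaker* than Diaz's (HT2) as vendored (`DiazMain.lean`, module
docstring "v2", and `Diaz1989_thm2.main_i_measureA`, `DiazMainProofs.lean`): Laurent's measure on
the `yⱼ` (Diaz's `u_h`) carries an unspecified constant, `|∑ μⱼyⱼ| ≥ exp(-C·H^{η₁})`
(`LinIndepMeasure`), where Diaz's (HT2)(a) has the constant `1` with the *same* exponent
`η₁ = mn/(2m+n)`; and this exponent is *critical* for the tree's formalisation of Diaz's proof of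
Théorème 2 (`DiazThm2.eventually_C9`: condition `(2m+n)η_a ≤ mn`), so — unlike for assertion ii)
(`DiazMainIIProofs.lean`, where `DiazThm1.eventually_goodX` has slack in the exponent) — the
constant cannot be absorbed by raising the exponent (`LinIndepMeasure.measureA_of_lt`). It is
absorbed instead by the factor `log X` of `Ψ = X^{mn} log X` (the radius `ρ = 16(n+1)Ψ` of the
ball and the smallness exponent): in step (𝒞9) of §II-3-4 the technical hypothesis is used only to
bound `|λ.u|, |μ.v|` from below by `exp(-Ψ(X))` for the small pair `(λ, μ)` produced by the zero
lemma, `|λ| ≲ X^{2m+n}`, `|μ| ≲ X^{m+2n}`, and `C·(K X^{2m+n})^{η₁} = C K^{η₁} X^{mn} ≤ X^{mn} log X`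
for large `X`, whatever `C`. Accordingly this file re-runs the tail of `DiazThm2Proofs.lean` with
lower bounds of Laurent's shape:

1. `DiazThm2.C9_atC`, `DiazThm2.eventually_C9C` — (𝒞9) for lower bounds `exp(-C_a B^{η_a})`,
   `exp(-C_b B^{η_b})` (`max|λᵢ| ≤ B`) with `(2m+n)η_a ≤ mn`, `(m+2n)η_b ≤ mn` and ANY constants;
2. `DiazThm2.eventually_zeroFreeC`, `DiazThm2.eventually_goodXC` — no common zero of the `Q_{μj}`
   in the ball `𝓑_ρ`, and "all large `X` are good" (`DiazThm2.GoodX`), under Laurent-type measures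
   (the separation of the interpolation points in `DiazThm2Smallness.eventually_small` takes
   Diaz's (HT2)(b) with an arbitrary exponent, which the linear measure on the `xᵢ` supplies for
   every exponent `> 1`, `LinIndepMeasure.measureB_of_one_lt`);
3. `DiazThm2.le_trdeg_of_eventually_goodX_crit` — the exponent-free form of the conclusion of
   `Diaz1989_thm2_of_criterion` (§II-4-3 of Diaz: Philippon's criterion applied to the family
   `𝓕_N` at `X_N = N + N₁`, at the point `θ'' = (0, …, 0, e^{u_hv_k})`), with "all large `X` are
   good" in place of (HT2); its body is that of `Diaz1989_thm2_of_criterion` from that point on,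
   verbatim (the Ch. 8 route already has this form: `le_trdeg_of_eventually_goodX_ch8'`);
4. `Diaz1989_main_i_of_core` — the glue: in Laurent's large range `2(m+n) ≤ mn` one has
   `m + 2n < mn` (`Diaz1989_main_i.add_two_mul_lt_mul`), so with `u = y` (exponent `η₁`,
   `(2m+n)η₁ = mn`) and `v = x` (exponent `1`, `(m+2n)·1 ≤ mn`) all large `X` are good, and any
   core concluding from there gives the bound for `ℚ(e^{y_hx_k}) = ℚ(e^{xᵢyⱼ})`; the small range is
   `Diaz1989_main_i_smallRange` (six exponentials) through `Diaz1989_main_i_of_largeRange`.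

## References

* M. Laurent, *Sur quelques résultats récents de transcendance*, Journées Arithmétiques de Luminy
  1989, Astérisque 198–200 (1991), 209–230, §3.1, Théorème 3 i), p. 213. [Laurent1991]
* G. Diaz, *Grands degrés de transcendance pour des familles d'exponentielles*, J. Number Theory
  31 (1989), 1–23, Théorème 2, p. 2; §II-3-4 (𝒞9) p. 14; §II-4-3 p. 16. [Diaz1989]
* P. Philippon, *Critères pour l'indépendance algébrique*, Publ. Math. IHÉS 64 (1986), 5–52,
  Thm 2.11; *Lemmes de zéros dans les groupes algébriques commutatifs*, Bull. Soc. Math. France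
  114 (1986), 355–383. [Philippon1986Criteres]
* Yu. V. Nesterenko, P. Philippon (eds.), *Introduction to Algebraic Independence Theory*,
  LNM 1752, Springer 2001, Ch. 8 §1 Corollary 1.1; Ch. 14 (M. Waldschmidt) Thm 2.7 and §3.
  [NesterenkoPhilippon2001]
-/

noncomputable section

open Filter Real Finset Literature.NumberTheory.Transcendental.Asymp MvPolynomial
  Literature.NumberTheory.Transcendental.Chudnovsky Literature.NumberTheory.Transcendental.Taylor

namespace Literature.NumberTheory.Transcendental

namespace DiazThm2

open DiazThm1 (a1 a2 one_le_a1 one_le_a2 Var theta Unk Q Qj IsMinIdx exists_isMinIdx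
  ZeroLemmaAt exists_zeroLemmaAt Delta0 Delta0_pos half_cube_mul_exp_lt rpow_le_of_le_mul_scale
  one_le_scale varEquiv l1_rename_of_injective trdeg_adjoin_congr three_le_X)

variable {m n : ℕ}

/-! ### (𝒞9) with lower bounds of Laurent's shape `exp(-C B^η)` -/

/-- **(𝒞9) at a fixed `X`, for lower bounds with constants** (the pointwise form of
`eventually_C9C`; cf. `C9_at`): if `|λ.u| ≥ exp(-C_a B^{η_a})` and `|μ.v| ≥ exp(-C_b B^{η_b})` for
all nonzero `λ`, `μ` with `max|λᵢ| ≤ B`, resp. `max|μ_k| ≤ B`, and the three dominations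
`C_a (cΔa₁²a₂)^{η_a} X^{(2m+n)η_a} ≤ Ψ`, `C_b (cΔa₁a₂²)^{η_b} X^{(m+2n)η_b} ≤ Ψ`,
`2cΔa₁²a₂² X^{2m+2n} ≤ Ψ³` (`Ψ = X^{mn} log X`) hold at `X ≥ e`, then no nonzero `(λ, μ)` satisfies
(12) with `V = ρ/2`. [cite: Diaz1989, §II-3-4 (𝒞9) p. 14] -/
theorem C9_atC {u : Fin n → ℂ} {v : Fin m → ℂ} {ηa ηb : ℝ} (hηa : 0 ≤ ηa) (hηb : 0 ≤ ηb)
    {c Δ Ca Cb : ℝ} (hc : 0 < c) (hΔ : 0 < Δ) (hCa : 0 ≤ Ca) (hCb : 0 ≤ Cb)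
    (hAl : ∀ lam : Fin n → ℤ, lam ≠ 0 → ∀ B : ℝ, (∀ i, (|lam i| : ℝ) ≤ B) →
      Real.exp (-(Ca * B ^ ηa)) ≤ ‖∑ i, (lam i : ℂ) * u i‖)
    (hBl : ∀ mu : Fin m → ℤ, mu ≠ 0 → ∀ B : ℝ, (∀ k, (|mu k| : ℝ) ≤ B) →
      Real.exp (-(Cb * B ^ ηb)) ≤ ‖∑ k, (mu k : ℂ) * v k‖)
    {X : ℝ} (hXe : Real.exp 1 ≤ X) (hX1 : 1 < X)
    (hA1 : Ca * (c * Δ * ((a1 m n : ℝ) ^ 2 * a2 m n)) ^ ηa *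
        scale ((2 * m + n) * ηa) (0 * ηa) X ≤ scale (m * n) 1 X)
    (hB1 : Cb * (c * Δ * ((a1 m n : ℝ) * (a2 m n) ^ 2)) ^ ηb *
        scale ((m + 2 * n) * ηb) (0 * ηb) X ≤ scale (m * n) 1 X)
    (hP1 : 2 * (c * Δ * ((a1 m n : ℝ) ^ 2 * (a2 m n) ^ 2)) * scale (2 * m + 2 * n) 0 X ≤
      scale (3 * (m * n)) 3 X)
    (lam : Fin n → ℤ) (mu : Fin m → ℤ) (hlam : lam ≠ 0) (hmu : mu ≠ 0)
    (hlamB : ∀ i, (|lam i| : ℝ) ≤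
      c * Δ * ((Lq m n X - 1 : ℕ) : ℝ) ^ 2 * (((M1q m n X - 1 : ℕ) : ℝ) / (n + 1)))
    (hmuB : ∀ k, (|mu k| : ℝ) ≤
      c * Δ * ((Lq m n X - 1 : ℕ) : ℝ) * (((M1q m n X - 1 : ℕ) : ℝ) / (n + 1)) ^ 2) :
    c * Δ * ((Lq m n X - 1 : ℕ) : ℝ) ^ 2 * (((M1q m n X - 1 : ℕ) : ℝ) / (n + 1)) ^ 2 *
        Real.exp (-(rhoq m n X / 2)) <
      ‖∑ i, (lam i : ℂ) * u i‖ * ‖∑ k, (mu k : ℂ) * v k‖ := by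
  have hcΔ : 0 ≤ c * Δ := by positivity
  have hP1' : 1 ≤ scale (m * n) 1 X := one_le_scale (by positivity) zero_le_one hXe
  -- the three bounds of (12) as multiples of scales
  have hbl : c * Δ * ((Lq m n X - 1 : ℕ) : ℝ) ^ 2 * (((M1q m n X - 1 : ℕ) : ℝ) / (n + 1)) ≤
      c * Δ * ((a1 m n : ℝ) ^ 2 * a2 m n) * scale (2 * m + n) 0 X := by
    have := mul_le_mul_of_nonneg_left (bound_lam_le (m := m) (n := n) hX1) hcΔ
    calc _ = c * Δ * (((Lq m n X - 1 : ℕ) : ℝ) ^ 2 * (((M1q m n X - 1 : ℕ) : ℝ) / (n + 1))) := by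
          ring
      _ ≤ _ := this
      _ = _ := by ring
  have hbm : c * Δ * ((Lq m n X - 1 : ℕ) : ℝ) * (((M1q m n X - 1 : ℕ) : ℝ) / (n + 1)) ^ 2 ≤
      c * Δ * ((a1 m n : ℝ) * (a2 m n) ^ 2) * scale (m + 2 * n) 0 X := by
    have := mul_le_mul_of_nonneg_left (bound_mu_le (m := m) (n := n) hX1) hcΔ
    calc _ = c * Δ * (((Lq m n X - 1 : ℕ) : ℝ) * (((M1q m n X - 1 : ℕ) : ℝ) / (n + 1)) ^ 2) := by
          ring
      _ ≤ _ := this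
      _ = _ := by ring
  have hbp : c * Δ * ((Lq m n X - 1 : ℕ) : ℝ) ^ 2 * (((M1q m n X - 1 : ℕ) : ℝ) / (n + 1)) ^ 2 ≤
      c * Δ * ((a1 m n : ℝ) ^ 2 * (a2 m n) ^ 2) * scale (2 * m + 2 * n) 0 X := by
    have := mul_le_mul_of_nonneg_left (bound_prod_le (m := m) (n := n) hX1) hcΔ
    calc _ = c * Δ * (((Lq m n X - 1 : ℕ) : ℝ) ^ 2 * (((M1q m n X - 1 : ℕ) : ℝ) / (n + 1)) ^ 2) := by
          ring
      _ ≤ _ := this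
      _ = _ := by ring
  have hb0 : 0 ≤ c * Δ * ((Lq m n X - 1 : ℕ) : ℝ) ^ 2 * (((M1q m n X - 1 : ℕ) : ℝ) / (n + 1)) := by
    positivity
  have hb0' : 0 ≤ c * Δ * ((Lq m n X - 1 : ℕ) : ℝ) * (((M1q m n X - 1 : ℕ) : ℝ) / (n + 1)) ^ 2 := by
    positivity
  -- lower bound for `|λ.u|`: the constant `C_a` is absorbed by the domination `hA1`
  have hTa : Ca * (c * Δ * ((Lq m n X - 1 : ℕ) : ℝ) ^ 2 * (((M1q m n X - 1 : ℕ) : ℝ) / (n + 1))) ^ ηa ≤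
      scale (m * n) 1 X := by
    have h1 := rpow_le_of_le_mul_scale hX1.le (by positivity) hb0 hηa hbl
    calc Ca * (c * Δ * ((Lq m n X - 1 : ℕ) : ℝ) ^ 2 * (((M1q m n X - 1 : ℕ) : ℝ) / (n + 1))) ^ ηa
        ≤ Ca * ((c * Δ * ((a1 m n : ℝ) ^ 2 * a2 m n)) ^ ηa *
            scale ((2 * m + n) * ηa) (0 * ηa) X) := mul_le_mul_of_nonneg_left h1 hCa
      _ = Ca * (c * Δ * ((a1 m n : ℝ) ^ 2 * a2 m n)) ^ ηa *
            scale ((2 * m + n) * ηa) (0 * ηa) X := by ring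
      _ ≤ scale (m * n) 1 X := hA1
  have hLu : Real.exp (-scale (m * n) 1 X) ≤ ‖∑ i, (lam i : ℂ) * u i‖ :=
    le_trans (Real.exp_le_exp.mpr (neg_le_neg hTa)) (hAl lam hlam _ hlamB)
  -- lower bound for `|μ.v|`
  have hTb : Cb * (c * Δ * ((Lq m n X - 1 : ℕ) : ℝ) * (((M1q m n X - 1 : ℕ) : ℝ) / (n + 1)) ^ 2) ^ ηb ≤
      scale (m * n) 1 X := by
    have h1 := rpow_le_of_le_mul_scale hX1.le (by positivity) hb0' hηb hbm
    calc Cb * (c * Δ * ((Lq m n X - 1 : ℕ) : ℝ) * (((M1q m n X - 1 : ℕ) : ℝ) / (n + 1)) ^ 2) ^ ηb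
        ≤ Cb * ((c * Δ * ((a1 m n : ℝ) * (a2 m n) ^ 2)) ^ ηb *
            scale ((m + 2 * n) * ηb) (0 * ηb) X) := mul_le_mul_of_nonneg_left h1 hCb
      _ = Cb * (c * Δ * ((a1 m n : ℝ) * (a2 m n) ^ 2)) ^ ηb *
            scale ((m + 2 * n) * ηb) (0 * ηb) X := by ring
      _ ≤ scale (m * n) 1 X := hB1
  have hLv : Real.exp (-scale (m * n) 1 X) ≤ ‖∑ k, (mu k : ℂ) * v k‖ :=
    le_trans (Real.exp_le_exp.mpr (neg_le_neg hTb)) (hBl mu hmu _ hmuB)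
  -- the product of the lower bounds beats the upper bound (12)
  have hprod : Real.exp (-(2 * scale (m * n) 1 X)) ≤
      ‖∑ i, (lam i : ℂ) * u i‖ * ‖∑ k, (mu k : ℂ) * v k‖ := by
    calc Real.exp (-(2 * scale (m * n) 1 X))
        = Real.exp (-scale (m * n) 1 X) * Real.exp (-scale (m * n) 1 X) := by
          rw [← Real.exp_add]; ring_nf
      _ ≤ _ := mul_le_mul hLu hLv (Real.exp_pos _).le (norm_nonneg _)
  have h3 : scale (3 * (m * n)) 3 X = scale (m * n) 1 X ^ 3 := by
    rw [scale_pow hX1.le]; ring_nf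
  have hsP3 : c * Δ * ((a1 m n : ℝ) ^ 2 * (a2 m n) ^ 2) * scale (2 * m + 2 * n) 0 X ≤
        scale (m * n) 1 X ^ 3 / 2 := by
    rw [h3] at hP1; linarith
  have hρ : rhoq m n X = 16 * (n + 1) * scale (m * n) 1 X := rfl
  calc c * Δ * ((Lq m n X - 1 : ℕ) : ℝ) ^ 2 * (((M1q m n X - 1 : ℕ) : ℝ) / (n + 1)) ^ 2 *
        Real.exp (-(rhoq m n X / 2))
      ≤ scale (m * n) 1 X ^ 3 / 2 * Real.exp (-(16 * (n + 1) * scale (m * n) 1 X / 2)) := by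
        rw [hρ]
        exact mul_le_mul_of_nonneg_right (hbp.trans hsP3) (Real.exp_pos _).le
    _ < Real.exp (-(2 * scale (m * n) 1 X)) := half_cube_mul_exp_lt hP1' n
    _ ≤ _ := hprod

/-- **(𝒞9) eventually, under measures of linear independence of Laurent's shape**: if `u` has a
measure of linear independence with exponent `η_a ≥ 0`, `(2m+n)η_a ≤ mn`, and `v` one with
exponent `η_b ≥ 0`, `(m+2n)η_b ≤ mn` (`LinIndepMeasure`: any constants — Laurent's `η₁ = mn/(2m+n)`
on the `yⱼ = u_h` and the linear measure on the `xᵢ = v_k` qualify as soon as `m + 2n ≤ mn`), then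
for all large `X` no nonzero pair `(λ, μ)` satisfies the conclusion (12) of the zero lemma taken
with `D₁ = L-1`, `S = M₁-1`, `V = ρ/2` and fixed `c, Δ > 0` (the constants are absorbed by the
factor `log X` of `Ψ`). [cite: Diaz1989, §II-3-4 (𝒞9) p. 14]
[cite: Laurent1991, §3.1 Théorème 3 (hypotheses), p. 213] -/
theorem eventually_C9C (hmn : m + n < m * n) {u : Fin n → ℂ} {v : Fin m → ℂ} {ηa ηb : ℝ}
    (hA : LinIndepMeasure u ηa) (hB : LinIndepMeasure v ηb)
    (hηa : 0 ≤ ηa) (hηa' : (2 * (m : ℝ) + n) * ηa ≤ m * n)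
    (hηb : 0 ≤ ηb) (hηb' : ((m : ℝ) + 2 * n) * ηb ≤ m * n) {c Δ : ℝ} (hc : 0 < c) (hΔ : 0 < Δ) :
    ∀ᶠ X in atTop, ∀ (lam : Fin n → ℤ) (mu : Fin m → ℤ), lam ≠ 0 → mu ≠ 0 →
      (∀ i, (|lam i| : ℝ) ≤
        c * Δ * ((Lq m n X - 1 : ℕ) : ℝ) ^ 2 * (((M1q m n X - 1 : ℕ) : ℝ) / (n + 1))) →
      (∀ k, (|mu k| : ℝ) ≤
        c * Δ * ((Lq m n X - 1 : ℕ) : ℝ) * (((M1q m n X - 1 : ℕ) : ℝ) / (n + 1)) ^ 2) →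
      c * Δ * ((Lq m n X - 1 : ℕ) : ℝ) ^ 2 * (((M1q m n X - 1 : ℕ) : ℝ) / (n + 1)) ^ 2 *
          Real.exp (-(rhoq m n X / 2)) <
        ‖∑ i, (lam i : ℂ) * u i‖ * ‖∑ k, (mu k : ℂ) * v k‖ := by
  obtain ⟨Ca, hCa, hAl⟩ := hA
  obtain ⟨Cb, hCb, hBl⟩ := hB
  have hlt3 : 2 * (m : ℝ) + 2 * n < 3 * (m * n) := by
    have h1 : ((m + n : ℕ) : ℝ) < ((m * n : ℕ) : ℝ) := by exact_mod_cast hmn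
    push_cast at h1
    have h2 : (0 : ℝ) ≤ (m : ℝ) * n := by positivity
    linarith
  have hA' := eventually_mul_scale_zero_le hηa'
    (Ca * (c * Δ * ((a1 m n : ℝ) ^ 2 * a2 m n)) ^ ηa)
  have hB' := eventually_mul_scale_zero_le hηb'
    (Cb * (c * Δ * ((a1 m n : ℝ) * (a2 m n) ^ 2)) ^ ηb)
  filter_upwards [hA', hB', eventually_mul_scale_le_of_lt hlt3 0 3
      (2 * (c * Δ * ((a1 m n : ℝ) ^ 2 * (a2 m n) ^ 2))),
    eventually_ge_atTop (Real.exp 1), eventually_gt_atTop (1 : ℝ)]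
    with X hA1 hB1 hP1 hXe hX1 lam mu hlam hmu hlamB hmuB
  refine C9_atC hηa hηb hc hΔ hCa.le hCb.le hAl hBl hXe hX1 ?_ ?_ hP1 lam mu hlam hmu hlamB hmuB
  · simpa only [zero_mul] using hA1
  · simpa only [zero_mul] using hB1

/-! ### No common zero in the ball, and "all large `X` are good", under Laurent-type measures -/

/-- **§II-3-4, conclusion, under measures of Laurent's shape: the `Q_{μj}`, `|μ| < M₁`, have no
common zero in `𝓑_ρ`** (the statement of `eventually_zeroFree` with `LinIndepMeasure u η_a`,
`LinIndepMeasure v η_b` in place of (HT2)(a), (b); same proof, with `eventually_C9C`).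
[cite: Diaz1989, §II-3-4 pp. 12–14] -/
theorem eventually_zeroFreeC (hn : 1 ≤ n) (hmn : m + n < m * n) {c : ℝ} (hc : 0 < c)
    (hZc : ZeroLemmaAt n hn c) {u : Fin n → ℂ} {v : Fin m → ℂ} (hu : LinearIndependent ℚ u)
    (hv : LinearIndependent ℚ v) {ηa ηb : ℝ}
    (hA : LinIndepMeasure u ηa) (hB : LinIndepMeasure v ηb)
    (hηa : 0 ≤ ηa) (hηa' : (2 * (m : ℝ) + n) * ηa ≤ m * n)
    (hηb : 0 ≤ ηb) (hηb' : ((m : ℝ) + 2 * n) * ηb ≤ m * n) :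
    ∀ᶠ X in atTop, ∀ (M : ℕ) (p : Unk m n 1 (Lq m n X) M → ℤ) (θ' : Var m n → ℂ),
      (∀ i, ‖theta u v i - θ' i‖ ≤ Real.exp (-rhoq m n X)) →
      ∀ j : Var m n →₀ ℕ, IsMinIdx p θ' j →
        ∃ μ : Fin m → ℕ, (∀ k, μ k < M1q m n X) ∧ aeval θ' (Qj p μ j) ≠ 0 := by
  have hm : 2 ≤ m := by
    rcases Nat.lt_or_ge m 2 with h | h
    · have : m * n ≤ 1 * n := Nat.mul_le_mul_right n (by omega)
      omega
    · exact h
  have hm1 : 1 ≤ m := by omega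
  have hΔ := Delta0_pos u v
  have hρ4 : ∀ᶠ X in atTop,
      4 * ((∑ h, ∑ k, ‖Complex.exp (-(u h * v k))‖) + m + 1) ≤ rhoq m n X := by
    have h := eventually_const_le_scale (a := (m : ℝ) * n) (b := 1) (Or.inl (by
      have : (1 : ℝ) ≤ m := by exact_mod_cast hm1
      have : (1 : ℝ) ≤ n := by exact_mod_cast hn
      positivity)) (4 * ((∑ h, ∑ k, ‖Complex.exp (-(u h * v k))‖) + m + 1))
    filter_upwards [h, eventually_ge_atTop (1 : ℝ)] with X hX hX1
    have hs := scale_nonneg (a := (m : ℝ) * n) (b := 1) hX1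
    have hn0 : (0 : ℝ) ≤ n := Nat.cast_nonneg n
    calc _ ≤ scale (m * n) 1 X := hX
      _ ≤ 16 * (n + 1) * scale (m * n) 1 X := by nlinarith
      _ = rhoq m n X := rfl
  filter_upwards [hρ4, eventually_L_ge (m := m) (n := n) hm1, eventually_M_ge (n := n) hn,
    eventually_C7 (m := m) (n := n) hm1 hn, eventually_C8 (m := m) hn hmn,
    eventually_C9C hmn hA hB hηa hηa' hηb hηb' hc hΔ, eventually_gt_atTop (0 : ℝ)]
    with X hρ hL hM h7 h8 h9 hX0 M p θ' hθ' j hj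
  obtain ⟨hne, h10a, h10b, h10c, h10d, h10e⟩ := ball_hyps hn u v hρ hθ'
  have hρpos : 0 < rhoq m n X / 2 := by
    have hE : 0 ≤ ∑ h, ∑ k, ‖Complex.exp (-(u h * v k))‖ :=
      Finset.sum_nonneg fun h _ => Finset.sum_nonneg fun k _ => norm_nonneg _
    have hm0 : (0 : ℝ) ≤ m := Nat.cast_nonneg m
    linarith
  have hM₁ : 2 ≤ M1q m n X := by
    unfold M1q
    calc 2 ≤ 1 * 2 := by norm_num
      _ ≤ a2 m n * Mq n X := Nat.mul_le_mul one_le_a2 hM.2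
  rcases exists_aeval_Qj_ne_zero_or hn hm hZc u v hu hv p hj hne hρpos hΔ h10a h10b h10c h10d
      h10e hL.2 hM₁ h7 h8 with h | ⟨lam, mu, hlam, hmu, hl, hμ, hprod⟩
  · exact h
  · exact absurd hprod (not_le.mpr (h9 lam mu hlam hmu hl hμ))

/-- **All large `X` are good under measures of Laurent's shape** (the statement of
`eventually_goodX` with `LinIndepMeasure u η_a`, `LinIndepMeasure v η_b` in place of (HT2)(a), (b)
for the zero-freeness, and (HT2)(b) for `v` with an arbitrary exponent `η` for the separation of
the interpolation points in the smallness estimate `eventually_small`).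
[cite: Diaz1989, §II-4-2 p. 15] -/
theorem eventually_goodXC {m' : ℕ} (u : Fin n → ℂ) (v : Fin (m' + 1) → ℂ) (hm' : 1 ≤ m')
    (hn : 1 ≤ n) (hmn : (m' + 1) + n < (m' + 1) * n) {c : ℝ} (hc : 0 < c)
    (hZc : ZeroLemmaAt n hn c) (hu : LinearIndependent ℚ u) (hv : LinearIndependent ℚ v)
    {ηa ηb η : ℝ} (hA : LinIndepMeasure u ηa) (hB : LinIndepMeasure v ηb)
    (hBη : Diaz1989.MeasureB v η)
    (hηa : 0 ≤ ηa) (hηa' : (2 * ((m' + 1 : ℕ) : ℝ) + n) * ηa ≤ (m' + 1 : ℕ) * n)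
    (hηb : 0 ≤ ηb) (hηb' : (((m' + 1 : ℕ) : ℝ) + 2 * n) * ηb ≤ (m' + 1 : ℕ) * n) :
    ∀ᶠ X in atTop, GoodX u v X := by
  have hm : 1 ≤ m' + 1 := by omega
  have hS : ∀ᶠ X in atTop, 1 ≤ cSq (m' + 1) n * Psq (m' + 1) n X := by
    have hcS := cSq_pos (m := m' + 1) (n := n) hmn
    filter_upwards [eventually_const_le_scale (a := ((m' + 1 : ℕ) : ℝ) * n) (b := 1)
      (Or.inl (by
        have : (1 : ℝ) ≤ n := by exact_mod_cast hn
        positivity)) (1 / cSq (m' + 1) n)] with X hX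
    rw [Psq]
    have := mul_le_mul_of_nonneg_left hX hcS.le
    rw [mul_one_div_cancel hcS.ne'] at this
    push_cast at this ⊢
    exact this
  filter_upwards [eventually_ge_atTop (3 : ℝ), eventually_L_ge (m := m' + 1) (n := n) hm,
    eventually_M_ge (n := n) hn, eventually_C1 (m := m' + 1) (n := n) hm hn,
    eventually_small hm' hn hmn u v hBη, eventually_deg_len (m := m' + 1) (n := n) hm hn,
    eventually_zeroFreeC hn hmn hc hZc hu hv hA hB hηa hηa' hηb hηb', hS]
    with X h3 hL hM hC1 hsm hdl hzf hS1
  exact ⟨h3, hL.2, hM.2, hC1, hsm, hdl, hzf, hS1⟩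

/-! ### The conclusion of Diaz's proof of Théorème 2 from "all large `X` are good" (exponent-free form) -/

/-- **Diaz 1989, Théorème 2, §II-4-3 (the conclusion) through Philippon's main criterion,
exponent-free form.** If all large `X` are good for `u ∈ ℂⁿ`, `v ∈ ℂ^{m'+1}` (`GoodX`), with
`m = m' + 1 ≥ 2`, `n ≥ 1`, `mn > m + n`, then Philippon's main criterion (Thm 2.11), applied
exactly as in `Diaz1989_thm2_of_criterion` (whose proof this is, from the point where (HT2) has
been consumed by `eventually_goodX`: the family `𝓕_N` at `X_N = N + N₁`, read off at the point
`θ'' = (0, …, 0, e^{u_hv_k})`, `σ = δ = c_δΦ`, `R = ρ`, `S = c_SΨ`, `k + 1 = [mn/(m+n)]`), gives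
`trdeg_ℚ ℚ(e^{u_hv_k}) ≥ [mn/(m+n)]`. NOTE: the body below is that of `Diaz1989_thm2_of_criterion`
(`DiazThm2Proofs.lean`) from `exponent_facts` onward, verbatim up to the hypothesis `hgood`; a later
revision of `DiazThm2Proofs.lean` could re-derive `Diaz1989_thm2_of_criterion` from this theorem
and drop the duplicate (the Ch. 8 route is already in this form, `le_trdeg_of_eventually_goodX_ch8'`).
[cite: Diaz1989, §II-4-3 "Conclusion", p. 16; Théorème 2, p. 2] -/
theorem le_trdeg_of_eventually_goodX_crit (hC : Philippon1986_mainCriterion) {m' n : ℕ}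
    (hmn : (m' + 1) + n < (m' + 1) * n) (u : Fin n → ℂ) (v : Fin (m' + 1) → ℂ)
    (hgood : ∀ᶠ X in atTop, GoodX u v X) :
    (((((m' + 1) * n) / ((m' + 1) + n) : ℕ)) : Cardinal) ≤ Algebra.trdeg ℚ
        ↥(IntermediateField.adjoin ℚ
          (Set.range fun p : Fin n × Fin (m' + 1) => Complex.exp (u p.1 * v p.2))) := by
  -- the exponent `k + 1 = [mn/(m+n)]`
  obtain ⟨hk1, hk⟩ := exponent_facts (m := m' + 1) (n := n) hmn
  set k : ℕ := (m' + 1) * n / ((m' + 1) + n) - 1 with hkdef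
  -- the transported point `θ'' ∈ ℂ^q`
  set eV := varEquiv (m' + 1) n with heV
  set θ₀ : Var (m' + 1) n → ℂ :=
    Sum.elim (fun _ => (0 : ℂ)) (fun p : Fin n × Fin (m' + 1) => Complex.exp (u p.1 * v p.2)) with hθ₀
  set θq : Fin ((m' + 1) + n * (m' + 1)) → ℂ := θ₀ ∘ eV.symm with hθq
  have hθ₀inr : ∀ q, θ₀ (Sum.inr q) = theta u v (Sum.inr q) := fun q => by
    simp [hθ₀]
  have hkq : k ≤ (m' + 1) + n * (m' + 1) := by
    have h1 : (m' + 1) * n / ((m' + 1) + n) ≤ (m' + 1) * n := Nat.div_le_self _ _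
    have h2 : (m' + 1) * n = n * (m' + 1) := Nat.mul_comm _ _
    omega
  obtain ⟨C, hC1, hcrit⟩ := hC _ k θq hkq
  -- a threshold `X₀` beyond which every `X` is good and the domination of the main inequality holds
  have hcS := cSq_pos (m := m' + 1) (n := n) hmn
  have hev := hgood.and
    (eventually_Phq_pow_le_Psq (m := m' + 1) (n := n) hk
      (Kmain (m' + 1) n k C / cSq (m' + 1) n ^ (k + 2)))
  obtain ⟨X₀, hX₀⟩ := Filter.eventually_atTop.mp hev
  set N₁ : ℕ := ⌈max X₀ 0⌉₊ + 3 with hN₁def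
  have hN₁3 : 3 ≤ N₁ := by omega
  have hXN : ∀ N : ℕ, X₀ ≤ (N : ℝ) + N₁ := fun N => by
    have h1 : X₀ ≤ ⌈max X₀ 0⌉₊ := (le_max_left _ _).trans (Nat.le_ceil _)
    have h2 : (N₁ : ℝ) = (⌈max X₀ 0⌉₊ : ℝ) + 3 := by rw [hN₁def]; push_cast; ring
    have h3 : (0 : ℝ) ≤ N := Nat.cast_nonneg N
    linarith
  have hG : ∀ N : ℕ, GoodX u v ((N : ℝ) + N₁) := fun N => (hX₀ _ (hXN N)).1
  have hE : ∀ N : ℕ, Kmain (m' + 1) n k C * Phq (m' + 1) n ((N : ℝ) + N₁) ^ (k + 1) ≤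
      cSq (m' + 1) n ^ (k + 2) * Psq (m' + 1) n ((N : ℝ) + N₁) := fun N => by
    have h := (hX₀ _ (hXN N)).2
    have hpos : 0 < cSq (m' + 1) n ^ (k + 2) := pow_pos hcS _
    have := mul_le_mul_of_nonneg_left h hpos.le
    rwa [← mul_assoc, mul_div_cancel₀ _ hpos.ne'] at this
  have hmn1 : 1 ≤ (m' + 1) + n := by omega
  -- the criterion
  have main := hcrit (sigF (m' + 1) n N₁) (sigF (m' + 1) n N₁) (RF (m' + 1) n N₁) (SF (m' + 1) n N₁)
    (sigF_mono hN₁3) (sigF_mono hN₁3) (RF_mono hN₁3) (SF_mono hN₁3)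
    (one_le_sigF hN₁3 hmn1) (one_le_sigF hN₁3 hmn1) (one_le_RF hN₁3) (fun N => (hG N).S_ge)
    (tendsto_sigF hN₁3 hmn1) (ratio_mono hN₁3 hk)
    (fun N => by
      have h := main_ineq_at (m := m' + 1) (n := n) (k := k) hC1
        (by linarith [three_le_X hN₁3 N]) (hE N)
      simp only [sigF, RF, SF, Nat.cast_succ]
      convert h using 4 <;> ring_nf)
    0 (fun N => Fintype.card (FamIdx (m' + 1) n ((N : ℝ) + N₁)))
    (fun N i => rename eV (famPoly u v ((N : ℝ) + N₁) ((Fintype.equivFin _).symm i)))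
    (fun N _ => by
      have hGN := hG N
      have hθ : θq ∘ eV = θ₀ := by
        funext x; simp [hθq]
      refine ⟨?_, ?_, ?_, ?_, ?_⟩
      · -- no common zero in the ball of radius `e^{-R(N)} = e^{-ρ}` around `θ''`
        refine Set.finite_empty.subset ?_
        rintro z ⟨hz, hz0⟩
        -- the point `(v_k, z_hk)` lies in the ball `𝓑_ρ` around `θ`
        set z' : Var (m' + 1) n → ℂ := Sum.elim v (fun q => z (eV (Sum.inr q))) with hz'
        have hball : InBall u v ((N : ℝ) + N₁) z' := by
          intro x
          cases x with
          | inl k' => simp [hz', le_of_lt (Real.exp_pos _)]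
          | inr q =>
            have := hz (eV (Sum.inr q))
            rw [norm_sub_rev]
            have e1 : θq (eV (Sum.inr q)) = theta u v (Sum.inr q) := by
              simp [hθq, hθ₀]
            simpa [hz', e1, RF] using this
        obtain ⟨i, hi⟩ := hGN.exists_ne_zero hball
        apply hi
        have := hz0 (Fintype.equivFin _ i)
        rw [aeval_rename, Equiv.symm_apply_apply] at this
        rw [← this]
        exact aeval_famPoly_congr (fun q => by simp [hz']) i
      · intro j
        refine le_trans ?_ (hGN.degLen_famPoly ((Fintype.equivFin _).symm j)).1
        exact_mod_cast totalDegree_rename_le _ _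
      · intro j
        rw [l1_rename_of_injective eV.injective]
        exact (hGN.degLen_famPoly ((Fintype.equivFin _).symm j)).2
      · obtain ⟨i, hi⟩ := hGN.exists_ne_zero_theta
        refine ⟨Fintype.equivFin _ i, ?_⟩
        rw [aeval_rename, hθ, Equiv.symm_apply_apply,
          aeval_famPoly_congr (θ₂ := theta u v) (fun q => hθ₀inr q) i]
        exact hi
      · intro j
        rw [aeval_rename, hθ, aeval_famPoly_congr (θ₂ := theta u v) (fun q => hθ₀inr q)]
        exact hGN.small_famPoly ((Fintype.equivFin _).symm j))
  -- conclusion: `ℚ(θ'') = ℚ(e^{uv})` and `k + 1 = [mn/(m+n)]`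
  have hr : Set.range θq = insert 0
      (Set.range fun p : Fin n × Fin (m' + 1) => Complex.exp (u p.1 * v p.2)) := by
    rw [hθq, eV.symm.surjective.range_comp, hθ₀, Set.Sum.elim_range, Set.range_const,
      Set.singleton_union]
  have hfin : (((((m' + 1) * n) / ((m' + 1) + n) : ℕ)) : Cardinal) ≤
      Algebra.trdeg ℚ ↥(IntermediateField.adjoin ℚ (Set.range θq)) := by
    rw [← hk1]; exact main
  refine hfin.trans_eq ?_
  rw [trdeg_adjoin_congr hr, adjoin_insert_zero_eq]

end DiazThm2

/-! ### Laurent's Théorème 3 i) from the tools -/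

open DiazThm2 in
open DiazThm1 (exists_zeroLemmaAt trdeg_adjoin_congr) in
/-- **`Diaz1989_main_i` from the zero lemma and any criterion concluding Diaz's proof of
Théorème 2 from "all large `X` are good"** (the shape of `DiazThm2.le_trdeg_of_eventually_goodX_crit`,
resp. of `le_trdeg_of_eventually_goodX_ch8'`). The small range `mn < 2(m+n)` is the six
exponentials theorem (`Diaz1989_main_i_of_largeRange`, `DiazMainProofs.lean`); in the large range
`2(m+n) ≤ mn` one has `m + 2n < mn` (`Diaz1989_main_i.add_two_mul_lt_mul`), so with `u = y`
(Laurent's measure of exponent `η₁ = mn/(2m+n)`, `(2m+n)η₁ = mn`), `v = x` (the linear measure,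
exponent `1`, `(m+2n)·1 ≤ mn`; and (HT2)(b) with exponent `2` for the separation of the
interpolation points, `LinIndepMeasure.measureB_of_one_lt`) all large `X` are good
(`DiazThm2.eventually_goodXC`), and the core gives the bound for `ℚ(e^{y_hx_k}) = ℚ(e^{xᵢyⱼ})`.
[cite: Laurent1991, §3.1 Théorème 3 i), p. 213]
[cite: Diaz1989, Théorème 2, p. 2; §II-4-3 p. 16] -/
theorem Diaz1989_main_i_of_core (hZ : Diaz1989_zeroLemma)
    (core : ∀ (m' n : ℕ), (m' + 1) + n < (m' + 1) * n → ∀ (u : Fin n → ℂ) (v : Fin (m' + 1) → ℂ),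
      (∀ᶠ X in atTop, GoodX u v X) →
      (((((m' + 1) * n) / ((m' + 1) + n) : ℕ)) : Cardinal) ≤ Algebra.trdeg ℚ
        ↥(IntermediateField.adjoin ℚ
          (Set.range fun p : Fin n × Fin (m' + 1) => Complex.exp (u p.1 * v p.2)))) :
    Diaz1989_main_i := by
  refine Diaz1989_main_i_of_largeRange ?_
  intro m n x y hx hy hxm hym hmn hlarge
  have hlt : m + n < m * n := Diaz1989_main_i.range_iff.mp hmn
  have hm2 : 2 ≤ m := by
    rcases hmn with ⟨hm, -⟩ | ⟨hm, -⟩ <;> omega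
  have hn : 1 ≤ n := by
    rcases hmn with ⟨-, hn⟩ | ⟨-, hn⟩ <;> omega
  obtain ⟨m', rfl⟩ : ∃ m', m = m' + 1 := ⟨m - 1, by omega⟩
  have hm' : 1 ≤ m' := by omega
  obtain ⟨c, hc, hZc⟩ := exists_zeroLemmaAt hZ n hn
  -- the exponents: `η_a = η₁ = mn/(2m+n)` for `u = y` (critical), `η_b = 1` for `v = x`
  have hmc : ((m' + 1 : ℕ) : ℝ) = (m' : ℝ) + 1 := by push_cast; ring
  have hηa : (0 : ℝ) ≤ ((m' + 1 : ℕ) * n : ℝ) / (2 * (m' + 1 : ℕ) + n) := by positivity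
  have hηa' : (2 * ((m' + 1 : ℕ) : ℝ) + n) * (((m' + 1 : ℕ) * n : ℝ) / (2 * (m' + 1 : ℕ) + n)) ≤
      (m' + 1 : ℕ) * n := by
    rw [hmc]
    have hd : (0 : ℝ) < 2 * ((m' : ℝ) + 1) + n := by positivity
    rw [mul_div_cancel₀ _ hd.ne']
  have hηb' : (((m' + 1 : ℕ) : ℝ) + 2 * n) * (1 : ℝ) ≤ (m' + 1 : ℕ) * n := by
    have h := Diaz1989_main_i.add_two_mul_lt_mul hlarge (by omega)
    rw [mul_one]
    exact_mod_cast h.le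
  -- (HT2)(b) with exponent `2` for the separation of the points `μ.x`
  have hB2 : Diaz1989.MeasureB x 2 := hxm.measureB_of_one_lt one_lt_two
  have hgood := eventually_goodXC y x hm' hn hlt hc hZc hy hx hym hxm hB2 hηa hηa' zero_le_one hηb'
  have main := core m' n hlt y x hgood
  have hr : (Set.range fun p : Fin n × Fin (m' + 1) => Complex.exp (y p.1 * x p.2)) =
      Set.range fun p : Fin (m' + 1) × Fin n => Complex.exp (x p.1 * y p.2) := by
    ext z
    constructor
    · rintro ⟨p, rfl⟩
      exact ⟨(p.2, p.1), by dsimp only; rw [mul_comm]⟩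
    · rintro ⟨p, rfl⟩
      exact ⟨(p.2, p.1), by dsimp only; rw [mul_comm]⟩
  exact main.trans_eq (trdeg_adjoin_congr hr)

/-- **`Diaz1989_main_i` (Laurent 1991, Théorème 3 i)) from Philippon's main criterion
(Philippon 1986, Thm 2.11) and the zero lemma of Diaz 1989** — the same two named tools as the
tree's `Diaz1989_thm2_of_criterion`. [cite: Laurent1991, §3.1 Théorème 3 i), p. 213]
[cite: Diaz1989, Théorème 2, p. 2; §II-4-3 p. 16] -/
theorem Diaz1989_main_i_of_criterion (hC : Philippon1986_mainCriterion) (hZ : Diaz1989_zeroLemma) :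
    Diaz1989_main_i :=
  Diaz1989_main_i_of_core hZ fun _ _ hmn u v hgood =>
    DiazThm2.le_trdeg_of_eventually_goodX_crit hC hmn u v hgood

/-- **`Diaz1989_main_i` from Philippon's main criterion and Philippon's zero estimate on
`𝔾ₐ × 𝔾ₘⁿ`** (the zero lemma being `Diaz1989_zeroLemma_of_P1n`): the trust base of Laurent's
Théorème 3 i) is now that of `Diaz1989_thm2` (`Diaz1989_thm2_of_philippon`).
[cite: Laurent1991, §3.1 Théorème 3 i), p. 213] -/
theorem Diaz1989_main_i_of_philippon (hC : Philippon1986_mainCriterion)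
    (hZ : Philippon1986_GaGm_P1n) : Diaz1989_main_i :=
  Diaz1989_main_i_of_criterion hC (Diaz1989_zeroLemma_of_P1n hZ)

/-- **`Diaz1989_main_i` from LNM 1752 Ch. 8 Corollary 1.1 and the zero lemma** (the route of
`Diaz1989_thm2_of_ch8`, through its exponent-free core `le_trdeg_of_eventually_goodX_ch8'`).
[cite: Laurent1991, §3.1 Théorème 3 i), p. 213]
[cite: NesterenkoPhilippon2001, Ch. 8 §1 Corollary 1.1 (PDF pp. 165–166)] -/
theorem Diaz1989_main_i_of_ch8 (hC : NesterenkoPhilippon2001_ch8_cor_1_1) (hZ : Diaz1989_zeroLemma) :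
    Diaz1989_main_i :=
  Diaz1989_main_i_of_core hZ fun _ _ hmn u v hgood =>
    le_trdeg_of_eventually_goodX_ch8' hC hmn u v hgood

/-- **`Diaz1989_main_i` from LNM 1752 Ch. 8 Corollary 1.1 and Philippon's zero estimate on
`𝔾ₐ × 𝔾ₘⁿ`** — the trust base the tree declares for `Diaz1989_thm2` via `Diaz1989_thm2_of_ch8_P1n`.
[cite: Laurent1991, §3.1 Théorème 3 i), p. 213] -/
theorem Diaz1989_main_i_of_ch8_P1n (hC : NesterenkoPhilippon2001_ch8_cor_1_1)
    (hZ : Philippon1986_GaGm_P1n) : Diaz1989_main_i :=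
  Diaz1989_main_i_of_ch8 hC (Diaz1989_zeroLemma_of_P1n hZ)

/-! ### What holds unconditionally: the range `[mn/(m+n)] ≤ 2` -/

/-- **Assertion i) holds unconditionally for `mn < 3(m+n)`** (i.e. `[mn/(m+n)] ≤ 2`): by the six
exponentials theorem when `[mn/(m+n)] ≤ 1` and by LNM 1752, Ch. 13, Thm 3.1 (i)
(`Laurent2001_thm_3_1_i_holds`: `mn ≥ 2m + 2n ⇒ trdeg ℚ(e^{xᵢyⱼ}) ≥ 2`, proved in the tree by
Schneider's method and Gel'fond's criterion) when `[mn/(m+n)] = 2` — in both cases with no measure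
of linear independence at all (Laurent 1991, Remarque 3, p. 214: "Il en est notamment ainsi en
degré de transcendance 0 ou 1 (i.e. `t_k ≥ 1` ou `2`)").
[cite: Laurent1991, §3.1 Théorème 3 i) p. 213 and Remarque 3 p. 214]
[cite: NesterenkoPhilippon2001, Ch. 13 Theorem 3.1 (i)] -/
theorem Diaz1989_main_i_midRange (m n : ℕ) (x : Fin m → ℂ) (y : Fin n → ℂ)
    (hx : LinearIndependent ℚ x) (hy : LinearIndependent ℚ y)
    (hmn : 2 ≤ m ∧ 3 ≤ n ∨ 3 ≤ m ∧ 2 ≤ n) (hmid : m * n < 3 * (m + n)) :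
    ((m * n / (m + n) : ℕ) : Cardinal) ≤ Algebra.trdeg ℚ
      ↥(IntermediateField.adjoin ℚ
        (Set.range fun p : Fin m × Fin n => Complex.exp (x p.1 * y p.2))) :=
  Diaz1989_main_i_midRange_of_thm_3_1_i Laurent2001_thm_3_1_i_holds m n x y hx hy hmn hmid

/-- **Reduction of `Diaz1989_main_i` to the range `3(m+n) ≤ mn`, unconditionally**: what is left
of Laurent's Théorème 3 i) after `Diaz1989_main_i_midRange` is the range `[mn/(m+n)] ≥ 3`, where a
criterion for algebraic independence is needed (`Diaz1989_main_i_of_criterion`).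
[cite: Laurent1991, §3.1 Théorème 3 i) p. 213 and Remarque 3 p. 214] -/
theorem Diaz1989_main_i_of_range_three_le
    (H : ∀ (m n : ℕ) (x : Fin m → ℂ) (y : Fin n → ℂ),
      LinearIndependent ℚ x → LinearIndependent ℚ y →
      LinIndepMeasure x 1 →
      LinIndepMeasure y ((m * n : ℝ) / (2 * m + n)) →
      (2 ≤ m ∧ 3 ≤ n ∨ 3 ≤ m ∧ 2 ≤ n) → 3 * (m + n) ≤ m * n →
        ((m * n / (m + n) : ℕ) : Cardinal) ≤ Algebra.trdeg ℚ
          ↥(IntermediateField.adjoin ℚ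
            (Set.range fun p : Fin m × Fin n => Complex.exp (x p.1 * y p.2)))) :
    Diaz1989_main_i :=
  Diaz1989_main_i_of_thm_3_1_i Laurent2001_thm_3_1_i_holds H

/-- **`Diaz1989_main_i` is equivalent to its restriction to the range `3(m+n) ≤ mn`** (the rest
being proved). [cite: Laurent1991, §3.1 Théorème 3 i) p. 213 and Remarque 3 p. 214] -/
theorem Diaz1989_main_i_iff_range_three_le :
    Diaz1989_main_i ↔
      ∀ (m n : ℕ) (x : Fin m → ℂ) (y : Fin n → ℂ),
        LinearIndependent ℚ x → LinearIndependent ℚ y →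
        LinIndepMeasure x 1 →
        LinIndepMeasure y ((m * n : ℝ) / (2 * m + n)) →
        (2 ≤ m ∧ 3 ≤ n ∨ 3 ≤ m ∧ 2 ≤ n) → 3 * (m + n) ≤ m * n →
          ((m * n / (m + n) : ℕ) : Cardinal) ≤ Algebra.trdeg ℚ
            ↥(IntermediateField.adjoin ℚ
              (Set.range fun p : Fin m × Fin n => Complex.exp (x p.1 * y p.2))) :=
  ⟨fun h m n x y hx hy hxm hym hmn _ => h m n x y hx hy hxm hym hmn,
    Diaz1989_main_i_of_range_three_le⟩

end Literature.NumberTheory.Transcendental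

end
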